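import Summits.ValiantsHypothesis.ValiantsHypothesis.Theorems.BarrierLeverChowThinRowsScaledForms

/-!
# Route BarrierLever — item `ChowHitsThinRowPartitionMinors` (stmt-ValiantsHypothesis-20195):
# prelims for the pair layer on FOREST layouts × arbitrary columns (omnibus form + incidence), I

Helper file (`--supports stmt-ValiantsHypothesis-20195`; cell valiant-natproofs, rung V4, 𝒟-side of
door (c); prover seat val-np-p2 gen 6).  Closes NO item; imports only val-np-p7 g4's
`…ChowThinRowsScaledForms`; no route file; no definitions.  Four bookkeeping lemmas for
`…ChowThinRowsForestIncidence` / `…ChowThinRowsForestAllColumns`: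
* `exists_ne_zero_det_add_smul_ne_zero` — GENERIC PERTURBATION: `det A ≠ 0 ⇒ det (A + t • N) ≠ 0`
  for some `t ≠ 0` (the determinant is a polynomial in `t`, nonzero at `t = 0`; via `ℂ[X]`);
* `card_singletons_union_image_le` — the index family `{singletons} ∪ {U i}` of a down-closed
  injective family `U : Fin r → Finset (Fin h)` with `r ≤ h + 1` has at most `h + h` members
  (the form budget; the count of `…ChowThinRowsAllColumns`, isolated);
* `sum_omnibus_mul`, `sum_erase_omnibus_mul` — sums of the OMNIBUS `x`-design
  `κ V = ω·[V = ∅] + π·[V = L]` against a function on the index family (and on it minus one index);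
* `tinvFamily_eq_zero` — the truncated inverses `t_{U k}` (`coeff_{y^X} t_V = [X ⊆ V]·(-1)^|X| |X|! ∏ γ`)
  of an injective family are linearly independent on the family itself (`⊆`-triangular with
  nonzero diagonal; downward induction on `|U (σ k)|`).

WHAT THIS IS NOT: bookkeeping only; nothing here on items 20195 / 20172 / 19717 themselves, on crux
stmt-ValiantsHypothesis-14610, or on `VP` versus `VNP`.
-/

set_option linter.dupNamespace false

namespace Summit.ValiantsHypothesis.ValiantsHypothesis.Theorems.BarrierLever.ChowThinAll

open Finset MvPolynomial

/-! ## 1. Generic perturbation of a nonsingular matrix -/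

/-- **Generic perturbation.**  If `det A ≠ 0` then `det (A + t • N) ≠ 0` for some `t ≠ 0`
(`det (A + t • N)` is a polynomial in `t` that does not vanish at `t = 0`). -/
theorem exists_ne_zero_det_add_smul_ne_zero {r : ℕ} (A N : Matrix (Fin r) (Fin r) ℂ)
    (hA : A.det ≠ 0) : ∃ t : ℂ, t ≠ 0 ∧ (A + t • N).det ≠ 0 := by
  classical
  set MX : Matrix (Fin r) (Fin r) (Polynomial ℂ) :=
    Matrix.of fun i j => Polynomial.C (A i j) + Polynomial.X * Polynomial.C (N i j) with hMX
  have hdet : ∀ t : ℂ, (A + t • N).det = Polynomial.eval t MX.det := by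
    intro t
    have e : A + t • N = (Polynomial.evalRingHom t).mapMatrix MX := by
      ext i j
      rw [RingHom.mapMatrix_apply, Matrix.map_apply, hMX, Matrix.of_apply, Matrix.add_apply,
        Matrix.smul_apply, smul_eq_mul, Polynomial.coe_evalRingHom, Polynomial.eval_add,
        Polynomial.eval_mul, Polynomial.eval_C, Polynomial.eval_X, Polynomial.eval_C]
    rw [e, ← RingHom.map_det]
    rfl
  have hMX0 : MX.det ≠ 0 := by
    intro e
    apply hA
    have h0 := hdet 0
    rw [zero_smul, add_zero] at h0
    rw [h0, e, Polynomial.eval_zero]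
  set p : Polynomial ℂ := Polynomial.X * MX.det with hp
  have hp0 : p ≠ 0 := mul_ne_zero Polynomial.X_ne_zero hMX0
  obtain ⟨t, ht⟩ := Infinite.exists_notMem_finset p.roots.toFinset
  have hpt : Polynomial.eval t p ≠ 0 := fun e =>
    ht (Multiset.mem_toFinset.mpr ((Polynomial.mem_roots hp0).mpr e))
  rw [hp, Polynomial.eval_mul, Polynomial.eval_X] at hpt
  refine ⟨t, fun e => hpt (by rw [e, zero_mul]), fun e => hpt ?_⟩
  rw [hdet t] at e
  rw [e, mul_zero]

/-! ## 2. The form budget: `|{singletons} ∪ Δ| ≤ h + h` -/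

/-- **Form budget.**  For an injective down-closed family `U : Fin r → Finset (Fin h)` with
`r ≤ h + 1` and `1 ≤ h`, the family of all singletons together with the `U i` has at most `h + h`
members (if `r = h + 1 ≥ 2` some `U i` is nonempty, so some singleton is a `U i'`). -/
theorem card_singletons_union_image_le {h r : ℕ} (hh : 1 ≤ h) (hr : r ≤ h + 1)
    (U : Fin r → Finset (Fin h)) (hUinj : Function.Injective U)
    (hUdown : ∀ i (S : Finset (Fin h)), S ⊆ U i → ∃ i', U i' = S) :
    (((Finset.univ : Finset (Fin h)).image fun c => ({c} : Finset (Fin h))) ∪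
      (Finset.univ : Finset (Fin r)).image U).card ≤ h + h := by
  classical
  set S₁ : Finset (Finset (Fin h)) := (Finset.univ : Finset (Fin h)).image fun c => ({c} : Finset (Fin h))
    with hS₁
  have hS₁card : S₁.card ≤ h :=
    Finset.card_image_le.trans (by rw [Finset.card_univ, Fintype.card_fin])
  have eU : ((Finset.univ : Finset (Fin r)).image U).card = r := by
    rw [Finset.card_image_of_injective _ hUinj, Finset.card_univ, Fintype.card_fin]
  rw [← Finset.union_sdiff_self_eq_union]
  refine (Finset.card_union_le _ _).trans ?_
  have hrest : (((Finset.univ : Finset (Fin r)).image U) \ S₁).card ≤ h := by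
    rcases Nat.lt_or_ge r (h + 1) with hlt | hge
    · exact (Finset.card_le_card Finset.sdiff_subset).trans (by rw [eU]; omega)
    · have hr2 : 2 ≤ r := by omega
      let i₁ : Fin r := ⟨0, by omega⟩
      let i₂ : Fin r := ⟨1, by omega⟩
      have hne : U i₁ ≠ U i₂ := fun e => by
        have := hUinj e
        simp [i₁, i₂, Fin.ext_iff] at this
      obtain ⟨i, hi⟩ : ∃ i, (U i).Nonempty := by
        by_cases h0 : U i₁ = ∅
        · refine ⟨i₂, Finset.nonempty_iff_ne_empty.mpr fun e => hne (h0.trans e.symm)⟩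
        · exact ⟨i₁, Finset.nonempty_iff_ne_empty.mpr h0⟩
      obtain ⟨c, hc⟩ := hi
      obtain ⟨i', hi'⟩ := hUdown i {c} (Finset.singleton_subset_iff.mpr hc)
      have hmem : ({c} : Finset (Fin h)) ∈ ((Finset.univ : Finset (Fin r)).image U) ∩ S₁ :=
        Finset.mem_inter.mpr ⟨Finset.mem_image.mpr ⟨i', Finset.mem_univ _, hi'⟩,
          Finset.mem_image.mpr ⟨c, Finset.mem_univ _, rfl⟩⟩
      have hpos : 1 ≤ ((((Finset.univ : Finset (Fin r)).image U) ∩ S₁)).card :=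
        Finset.card_pos.mpr ⟨_, hmem⟩
      have e := Finset.card_sdiff_add_card_inter ((Finset.univ : Finset (Fin r)).image U) S₁
      omega
  omega

/-! ## 3. Sums against the omnibus `x`-design -/

/-- Sum of the omnibus design `ω·[V = ∅] + π·[V = L]` against `f` over an index family containing
`∅` and `L`. -/
theorem sum_omnibus_mul {h : ℕ} (PT : Finset (Finset (Fin h))) (ω π : ℂ) (L : Finset (Fin h))
    (hE : (∅ : Finset (Fin h)) ∈ PT) (hL : L ∈ PT) (f : Finset (Fin h) → ℂ) :
    ∑ V ∈ PT, (ω * (if V = ∅ then 1 else 0) + π * (if V = L then 1 else 0)) * f V =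
      ω * f ∅ + π * f L := by
  classical
  have e1 : ∀ V ∈ PT, (ω * (if V = ∅ then 1 else 0) + π * (if V = L then 1 else 0)) * f V =
      ω * (if V = ∅ then f V else 0) + π * (if V = L then f V else 0) := by
    intro V _
    split_ifs <;> ring
  rw [Finset.sum_congr rfl e1, Finset.sum_add_distrib, ← Finset.mul_sum, ← Finset.mul_sum,
    Finset.sum_ite_eq' PT ∅ f, if_pos hE, Finset.sum_ite_eq' PT L f, if_pos hL]

/-- Sum of the omnibus design against `f` over the index family minus one index `V₁`. -/
theorem sum_erase_omnibus_mul {h : ℕ} (PT : Finset (Finset (Fin h))) (ω π : ℂ)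
    (L : Finset (Fin h)) (hE : (∅ : Finset (Fin h)) ∈ PT) (hL : L ∈ PT) (V₁ : Finset (Fin h))
    (f : Finset (Fin h) → ℂ) :
    ∑ V ∈ PT.erase V₁, (ω * (if V = ∅ then 1 else 0) + π * (if V = L then 1 else 0)) * f V =
      ω * (if V₁ = ∅ then 0 else f ∅) + π * (if V₁ = L then 0 else f L) := by
  classical
  have e1 : ∀ V ∈ PT.erase V₁, (ω * (if V = ∅ then 1 else 0) + π * (if V = L then 1 else 0)) * f V =
      ω * (if V = ∅ then f V else 0) + π * (if V = L then f V else 0) := by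
    intro V _
    split_ifs <;> ring
  have e2 : (∑ V ∈ PT.erase V₁, if V = ∅ then f V else 0) = if V₁ = ∅ then 0 else f ∅ := by
    rw [Finset.sum_ite_eq' (PT.erase V₁) ∅ f]
    by_cases h0 : V₁ = ∅
    · rw [if_pos h0, if_neg]
      rw [h0]
      exact Finset.notMem_erase ∅ PT
    · rw [if_neg h0, if_pos (Finset.mem_erase.mpr ⟨Ne.symm h0, hE⟩)]
  have e3 : (∑ V ∈ PT.erase V₁, if V = L then f V else 0) = if V₁ = L then 0 else f L := by
    rw [Finset.sum_ite_eq' (PT.erase V₁) L f]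
    by_cases h0 : V₁ = L
    · rw [if_pos h0, if_neg]
      rw [h0]
      exact Finset.notMem_erase L PT
    · rw [if_neg h0, if_pos (Finset.mem_erase.mpr ⟨Ne.symm h0, hL⟩)]
  rw [Finset.sum_congr rfl e1, Finset.sum_add_distrib, ← Finset.mul_sum, ← Finset.mul_sum, e2, e3]

/-! ## 4. The truncated inverses of an injective family are independent on the family -/

/-- **Triangularity of the truncated inverses.**  With `t_V(X) = [X ⊆ V]·(-1)^|X| |X|! ∏_{c∈X} γ V c`
(`coeff_tinvG`) and all `∏_{c ∈ V} γ V c ≠ 0`: if `Σ_k D k · t_{U (σ k)}(U i') = 0` for every `i'`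
(`U` injective, `σ` a permutation), then `D = 0`. -/
theorem tinvFamily_eq_zero {h r : ℕ} (U : Fin r → Finset (Fin h)) (hUinj : Function.Injective U)
    (σ : Fin r ≃ Fin r) (γ : Finset (Fin h) → Fin h → ℂ) (hγprod : ∀ V : Finset (Fin h), ∏ c ∈ V, γ V c ≠ 0)
    (D : Fin r → ℂ)
    (h1 : ∀ i', ∑ k, D k * (if U i' ⊆ U (σ k) then
      (-1 : ℂ) ^ (U i').card * ((U i').card.factorial : ℂ) * ∏ c ∈ U i', γ (U (σ k)) c else 0) = 0) :
    ∀ k, D k = 0 := by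
  classical
  have hind : ∀ n : ℕ, ∀ k, h - (U (σ k)).card = n → D k = 0 := by
    intro n
    induction n using Nat.strong_induction_on with
    | _ n ih =>
      intro k hn
      have hsum := h1 (σ k)
      rw [← Finset.add_sum_erase _ _ (Finset.mem_univ k)] at hsum
      have hrest : ∑ k₂ ∈ (Finset.univ : Finset (Fin r)).erase k,
          D k₂ * (if U (σ k) ⊆ U (σ k₂) then (-1 : ℂ) ^ (U (σ k)).card *
            ((U (σ k)).card.factorial : ℂ) * ∏ c ∈ U (σ k), γ (U (σ k₂)) c else 0) = 0 := by
        refine Finset.sum_eq_zero fun k₂ hk₂ => ?_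
        have hne : k₂ ≠ k := (Finset.mem_erase.mp hk₂).1
        by_cases hsub : U (σ k) ⊆ U (σ k₂)
        · have hne' : U (σ k) ≠ U (σ k₂) := fun e => hne (σ.injective (hUinj e)).symm
          have hlt : (U (σ k)).card < (U (σ k₂)).card :=
            Finset.card_lt_card (lt_of_le_of_ne hsub hne')
          have hle : (U (σ k₂)).card ≤ h := by simpa using Finset.card_le_univ (U (σ k₂))
          rw [ih (h - (U (σ k₂)).card) (by omega) k₂ rfl, zero_mul]
        · rw [if_neg hsub, mul_zero]
      rw [hrest, add_zero, if_pos (subset_refl _)] at hsum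
      have htop : (-1 : ℂ) ^ (U (σ k)).card * ((U (σ k)).card.factorial : ℂ) *
          ∏ c ∈ U (σ k), γ (U (σ k)) c ≠ 0 :=
        mul_ne_zero (mul_ne_zero (pow_ne_zero _ (by norm_num))
          (by exact_mod_cast (U (σ k)).card.factorial_ne_zero)) (hγprod _)
      exact (mul_eq_zero.mp hsum).resolve_right htop
  intro k
  exact hind _ k rfl

end Summit.ValiantsHypothesis.ValiantsHypothesis.Theorems.BarrierLever.ChowThinAll
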